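import Summits.CriticalPhenomena.PercolationContinuityZ3.Theorems.PercNearOneGluingNoHeavyQuantArmEntropicBound
import Summits.CriticalPhenomena.PercolationContinuityZ3.Theorems.PercNearOneGluingNoHeavyQuantOneArm
import HarnessLib

/-!
# PAPER-2 track, ARM-3 (route C2, part 3): subcritical arm decay (exponent `ν`) + subcritical susceptibility bound
# (exponent `g < 2`) ⇒ the polynomial one-arm bound at `p_c` with every exponent `c < (2−g)/ν`

builds on p205010 (kernel theorem, internal audit signed; external expert review pending).
Status sentence for p205010: "θ(p_c) = 0 on ℤ^d, all d ≥ 2 — kernel-verified (Lean 4/Mathlib, standard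
axioms); internal adversarial audit SIGNED 2026-08-20 04:29Z; external expert review pending."

Seat `prim-quant-arm-3`, `--supports stmt-CriticalPhenomena-4575`; pure proofs, no definitions.  The DICTIONARY form of
Dewan–Muirhead's conditional inequality `η₁ ≥ (2 − γ)/ν` (PTRF 185 (2023), Thm. 1.10): from the kernel one-arm entropic
inequality at `p_c` (`Quant.oneArm_criticalProb_le_entropic_chi`, part 2) and the two typed inputs of
`…QuantPowerLawInputs.lean` (`Quant.SubcriticalArmDecay d A ν δ₁`, `Quant.ChiSubcritPowerBound d M g δ₀` — consumed here as
their unfolded hypotheses so that this file does not depend on the review-queued definitions),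

* `Quant.oneArmPolyDecayAtCritical_of_subcriticalArmDecay` — **`∃ C, OneArmPolyDecayAtCritical d c C` for every
  `0 < c < (2−g)/ν`**: at `q = p_c − s_n`, `s_n^ν = A L log n / n`, `L = d − 1 + (2−g)/ν`, the entropic inequality gives
  `π_{p_c}(n) ≤ 2A n^{−(2−g)/ν} + K M (A L)^{(2−g)/ν} (log n)^{(2−g)/ν} n^{−(2−g)/ν}`, and the logarithm is absorbed into any
  smaller exponent (`Quant.log_rpow_le`);
* `Quant.oneArmPolyDecay_of_subcriticalArmDecay` — the existential (T1) form.

Honest status: CONDITIONAL dictionary entry; BOTH inputs are open for `3 ≤ d ≤ 6` (no power bound on `ξ` or `χ` below `p_c` is in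
print there); numerically `(2−γ)/ν ≈ 0.24 / 0.81 / 1.44` in `d = 3 / 4 / 5` (orientation only); in high dimensions `ν = 1/2`,
`γ = 1` and the conclusion is Kozma–Nachmias's exponent `2` up to the excluded endpoint (van Engelenburg–Garban–Panis–Severo
2025 obtain the endpoint with the sharp length of Duminil-Copin–Panis).  Nothing here is a rate for `d = 3`.
Memo: `run/shared/lean/prim/quant/prim-quant-arm-3/POWERLAW-SURVEY.md` §4(C).
[cite: DewanMuirhead2022, Thm. 1.10, Remark 1.11 and §2 (proof)] [cite: Hutchcroft2022Triangle, Thm. 4.1]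
-/

noncomputable section

namespace Summit.CriticalPhenomena.PercolationContinuityZ3.Theorems.Quant

open MeasureTheory Literature.Probability.Percolation Literature.Probability.LatticeModels
open scoped ENNReal

/-! ### §5. Route C2 as a dictionary theorem: subcritical arm decay (exponent `ν`) + susceptibility bound (exponent `g`)
### give the one-arm power law with every exponent `c < (2−g)/ν` (Dewan–Muirhead's `η₁ ≥ (2−γ)/ν`) -/

section RouteC2

variable {d : ℕ}

/-- `(log n)^a ≤ ε^{-a} n^{aε}` for `n ≥ 1`, `a ≥ 0`, `ε > 0` (from `log x ≤ x^ε/ε`). [folklore] -/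
theorem log_rpow_le (a ε : ℝ) (ha : 0 ≤ a) (hε : 0 < ε) {x : ℝ} (hx : 1 ≤ x) :
    Real.log x ^ a ≤ ε⁻¹ ^ a * x ^ (a * ε) := by
  have hx0 : 0 ≤ x := by linarith
  have hlog0 : 0 ≤ Real.log x := Real.log_nonneg hx
  have h := Real.log_le_rpow_div hx0 hε
  calc Real.log x ^ a ≤ (x ^ ε / ε) ^ a := Real.rpow_le_rpow hlog0 h ha
    _ = ε⁻¹ ^ a * x ^ (a * ε) := by
        rw [div_eq_mul_inv, Real.mul_rpow (Real.rpow_nonneg hx0 _) (by positivity), ← Real.rpow_mul hx0,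
          mul_comm ε a, mul_comm]

/-- **ROUTE C2 (kernel dictionary): subcritical one-arm decay with correlation-length exponent `ν` and a subcritical
susceptibility power bound with exponent `g < 2` give the polynomial one-arm bound at `p_c` with EVERY exponent
`c < (2 − g)/ν`** — `∃ C, OneArmPolyDecayAtCritical d c C`.  Proof: the one-arm entropic inequality at `p_c`
(`oneArm_criticalProb_le_entropic_chi`) at `q = p_c − s_n`, `s_n^ν = A L log n / n` with `L = d − 1 + (2−g)/ν`, gives
`π_{p_c}(n) ≤ 2A n^{d−1} n^{−L} + K M s_n^{2−g} ≤ C₁ (log n)^{(2−g)/ν} n^{−(2−g)/ν}` for large `n`, and the logarithm is absorbed into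
any smaller exponent.  In exponent language `1/ρ ≥ (2−γ)/ν` (Dewan–Muirhead 2023, Thm. 1.10, there conditional on the
existence of the exponents; here as an implication between explicit bounds).  CONDITIONAL: both inputs are open for `3 ≤ d ≤ 6`
(numerically `(2−γ)/ν ≈ 0.24 / 0.81 / 1.44` in `d = 3/4/5`, orientation only); in high dimensions (`ν = 1/2`, `g = 1`) the bound is
Kozma–Nachmias's exponent `2` up to the excluded endpoint.
[cite: DewanMuirhead2022, Thm. 1.10 and §2 (proof: P_{p_c}[A₁(R)] ≤ c (p_c−p')² χ(p') at R = C ξ(p') log ξ(p'))] -/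
theorem oneArmPolyDecayAtCritical_of_subcriticalArmDecay (hd : 2 ≤ d) {A ν δ₁ M g δ₀ : ℝ} (hν : 0 < ν)
    (hg : g < 2) (hδ₁ : 0 < δ₁) (hδ₀ : 0 < δ₀)
    (hArm : ∀ q : unitInterval, (criticalProbI d : ℝ) - δ₁ < q → (q : ℝ) < criticalProbI d → ∀ n : ℕ, 1 ≤ n →
      oneArmProb d q n ≤ A * (n : ℝ) ^ ((d : ℝ) - 1) * Real.exp (-(((criticalProbI d : ℝ) - q) ^ ν * n) / A))
    (hχ : ∀ q : unitInterval, (criticalProbI d : ℝ) - δ₀ < q → (q : ℝ) < criticalProbI d →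
      chi d q ≤ M * ((criticalProbI d : ℝ) - q) ^ (-g))
    {c : ℝ} (hc0 : 0 < c) (hc : c < (2 - g) / ν) :
    ∃ C : ℝ, OneArmPolyDecayAtCritical d c C := by
  have hd1 : 1 ≤ d := by omega
  set pc : ℝ := (criticalProbI d : ℝ) with hpcdef
  have hpc0 : 0 < pc := by rw [hpcdef, coe_criticalProbI]; exact criticalProb_zd_pos d hd1
  have hpc1 : pc < 1 := by rw [hpcdef, coe_criticalProbI]; exact criticalProb_zd_lt_one hd
  have hdR : (1 : ℝ) ≤ d := by exact_mod_cast hd1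
  -- the target exponent `a = (2-g)/ν > c` and the auxiliary exponent `L`
  set a : ℝ := (2 - g) / ν with ha
  have ha0 : 0 < a := by rw [ha]; exact div_pos (by linarith) hν
  have hca : c < a := hc
  set L : ℝ := (d : ℝ) - 1 + a with hL
  have hL0 : 0 < L := by rw [hL]; linarith
  -- WLOG `A ≥ 1`, `M > 0`
  set A' : ℝ := max A 1 with hA'
  have hA'1 : 1 ≤ A' := le_max_right _ _
  have hA'0 : 0 < A' := by linarith
  have hAA' : A ≤ A' := le_max_left _ _
  have hM0 : 0 < M := by
    -- test `hχ` at one point (`χ ≥ 1` below `p_c`)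
    set s₀ : ℝ := min δ₀ pc / 2 with hs₀
    have hmin : 0 < min δ₀ pc := lt_min hδ₀ hpc0
    have hs₀0 : 0 < s₀ := by rw [hs₀]; positivity
    have hs₀δ : s₀ < δ₀ := by have := min_le_left δ₀ pc; rw [hs₀]; linarith
    have hs₀p : s₀ < pc := by have := min_le_right δ₀ pc; rw [hs₀]; linarith
    set q : unitInterval := ⟨pc - s₀, ⟨by linarith, by linarith⟩⟩
    have h := hχ q (by show pc - δ₀ < pc - s₀; linarith) (by show pc - s₀ < pc; linarith)
    have hχ1 : 1 ≤ chi d q := one_le_chi hd q (by rw [← coe_criticalProbI]; show pc - s₀ < pc; linarith)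
    have hpow : 0 < (pc - (q : ℝ)) ^ (-g) := Real.rpow_pos_of_pos (by show 0 < pc - (pc - s₀); linarith) _
    by_contra hM; push Not at hM
    have : M * (pc - (q : ℝ)) ^ (-g) ≤ 0 := mul_nonpos_of_nonpos_of_nonneg hM hpow.le
    linarith
  -- the arm input with `A'` in place of `A`
  have hArm' : ∀ q : unitInterval, pc - δ₁ < q → (q : ℝ) < pc → ∀ n : ℕ, 1 ≤ n →
      oneArmProb d q n ≤ A' * (n : ℝ) ^ ((d : ℝ) - 1) * Real.exp (-((pc - q) ^ ν * n) / A') := by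
    intro q hq1 hq2 n hn
    have h := hArm q hq1 hq2 n hn
    have hn0 : (0 : ℝ) ≤ (n : ℝ) ^ ((d : ℝ) - 1) := Real.rpow_nonneg (Nat.cast_nonneg _) _
    have hx0 : 0 ≤ (pc - q) ^ ν * n := mul_nonneg (Real.rpow_nonneg (by linarith) _) (Nat.cast_nonneg _)
    by_cases hA0 : 0 < A
    · have hexp : Real.exp (-((pc - q) ^ ν * n) / A) ≤ Real.exp (-((pc - q) ^ ν * n) / A') := by
        apply Real.exp_le_exp.2
        rw [neg_div, neg_div, neg_le_neg_iff]
        exact div_le_div_of_nonneg_left hx0 hA0 hAA'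
      calc oneArmProb d q n ≤ A * (n : ℝ) ^ ((d : ℝ) - 1) * Real.exp (-((pc - q) ^ ν * n) / A) := h
        _ ≤ A' * (n : ℝ) ^ ((d : ℝ) - 1) * Real.exp (-((pc - q) ^ ν * n) / A') :=
            mul_le_mul (mul_le_mul_of_nonneg_right hAA' hn0) hexp (Real.exp_pos _).le (by positivity)
    · push Not at hA0
      have h1 : A * (n : ℝ) ^ ((d : ℝ) - 1) * Real.exp (-((pc - q) ^ ν * n) / A) ≤ 0 :=
        mul_nonpos_of_nonpos_of_nonneg (mul_nonpos_of_nonpos_of_nonneg hA0 hn0) (Real.exp_pos _).le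
      have h2 : 0 ≤ A' * (n : ℝ) ^ ((d : ℝ) - 1) * Real.exp (-((pc - q) ^ ν * n) / A') := by positivity
      linarith
  -- constants
  set K : ℝ := 16 * d / (pc * (1 - pc) ^ 2) with hK
  have hK0 : 0 < K := by
    have : 0 < pc * (1 - pc) ^ 2 := mul_pos hpc0 (pow_pos (by linarith) 2)
    rw [hK]; positivity
  set t₀ : ℝ := min (min δ₀ δ₁) (pc / 2) / 2 with ht₀
  have hmin0 : 0 < min (min δ₀ δ₁) (pc / 2) := lt_min (lt_min hδ₀ hδ₁) (by linarith)
  have ht₀0 : 0 < t₀ := by rw [ht₀]; positivity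
  have ht₀δ₀ : t₀ < δ₀ := by
    have := (min_le_left (min δ₀ δ₁) (pc / 2)).trans (min_le_left δ₀ δ₁); rw [ht₀]; linarith
  have ht₀δ₁ : t₀ < δ₁ := by
    have := (min_le_left (min δ₀ δ₁) (pc / 2)).trans (min_le_right δ₀ δ₁); rw [ht₀]; linarith
  have ht₀pc : t₀ ≤ pc / 2 := by
    have := min_le_right (min δ₀ δ₁) (pc / 2); rw [ht₀]; linarith
  set ε : ℝ := (a - c) / a with hε
  have hε0 : 0 < ε := by rw [hε]; exact div_pos (by linarith) ha0
  have haε : a * ε = a - c := by rw [hε]; field_simp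
  -- the threshold `n₁`: `2 A' L n^{-1/2} ≤ t₀^ν` for `n ≥ n₁`
  set B : ℝ := 2 * A' * L / t₀ ^ ν with hB
  have htν : 0 < t₀ ^ ν := Real.rpow_pos_of_pos ht₀0 ν
  have hB0 : 0 < B := by rw [hB]; positivity
  set n₁ : ℕ := max 3 ⌈B ^ 2⌉₊ with hn₁
  have hn₁3 : 3 ≤ n₁ := le_max_left _ _
  have hsmall : ∀ n : ℕ, n₁ ≤ n → A' * L * Real.log n / n ≤ t₀ ^ ν := by
    intro n hn
    have hn3 : (3 : ℝ) ≤ n := by exact_mod_cast hn₁3.trans hn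
    have hn0 : (0 : ℝ) < n := by linarith
    have hB2 : B ^ 2 ≤ n := by
      have h1 : (⌈B ^ 2⌉₊ : ℝ) ≤ n := by exact_mod_cast (le_max_right _ _).trans hn
      exact (Nat.le_ceil _).trans h1
    -- `log n ≤ 2 √n`
    have hlog : Real.log n ≤ 2 * (n : ℝ) ^ (1 / 2 : ℝ) := by
      have := Real.log_le_rpow_div hn0.le (by norm_num : (0 : ℝ) < 1 / 2)
      linarith
    -- `B ≤ √n`
    have hBs : B ≤ (n : ℝ) ^ (1 / 2 : ℝ) := by
      have h1 : B = (B ^ 2) ^ (1 / 2 : ℝ) := by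
        rw [← Real.sqrt_eq_rpow, Real.sqrt_sq hB0.le]
      rw [h1]
      exact Real.rpow_le_rpow (by positivity) hB2 (by norm_num)
    set r : ℝ := (n : ℝ) ^ (1 / 2 : ℝ) with hr
    have hsq : r * r = n := by
      rw [hr, ← Real.rpow_add hn0]; norm_num
    have hs0 : 0 < r := Real.rpow_pos_of_pos hn0 _
    -- `A' L log n / n ≤ 2 A' L n^{1/2} / n = 2A'L / n^{1/2} ≤ t₀^ν`
    have hstep : A' * L * (2 * r) / n = 2 * A' * L / r := by
      rw [← hsq]; field_simp
    calc A' * L * Real.log n / n ≤ A' * L * (2 * r) / n := by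
          gcongr
      _ = 2 * A' * L / r := hstep
      _ ≤ 2 * A' * L / B := div_le_div_of_nonneg_left (by positivity) hB0 hBs
      _ = t₀ ^ ν := by rw [hB]; field_simp
  -- the main estimate for `n ≥ n₁`
  set C₁ : ℝ := 2 * A' + K * M * (A' * L) ^ a * ε⁻¹ ^ a with hC₁
  have hC₁0 : 0 ≤ C₁ := by rw [hC₁]; positivity
  have hmain : ∀ n : ℕ, n₁ ≤ n →
      (bondPercolation (zdGraph d) (criticalProbI d)).real (siteToBoundary d n) ≤ C₁ * (n : ℝ) ^ (-c) := by
    intro n hn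
    have hn3 : (3 : ℝ) ≤ n := by exact_mod_cast hn₁3.trans hn
    have hn0 : (0 : ℝ) < n := by linarith
    have hn1 : (1 : ℝ) ≤ n := by linarith
    have hnn : 1 ≤ n := by exact_mod_cast hn1
    have hlog0 : 0 < Real.log n := Real.log_pos (by linarith)
    -- the scale `s = (A' L log n / n)^{1/ν}`
    set x : ℝ := A' * L * Real.log n / n with hx
    have hx0 : 0 < x := by rw [hx]; positivity
    set sn : ℝ := x ^ ν⁻¹ with hsn
    have hsn0 : 0 < sn := Real.rpow_pos_of_pos hx0 _
    have hsnν : sn ^ ν = x := by rw [hsn, Real.rpow_inv_rpow hx0.le hν.ne']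
    have hsnt : sn ≤ t₀ := by
      have h1 : x ≤ t₀ ^ ν := hsmall n hn
      calc sn = x ^ ν⁻¹ := rfl
        _ ≤ (t₀ ^ ν) ^ ν⁻¹ := Real.rpow_le_rpow hx0.le h1 (inv_nonneg.2 hν.le)
        _ = t₀ := Real.rpow_rpow_inv ht₀0.le hν.ne'
    -- the subcritical point `q = p_c − s`
    have hqI : pc - sn ∈ unitInterval := ⟨by linarith, by linarith⟩
    set q : unitInterval := ⟨pc - sn, hqI⟩ with hqdef
    have hqcoe : (q : ℝ) = pc - sn := rfl
    have hq0 : 0 < (q : ℝ) := by rw [hqcoe]; linarith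
    have hqc : (q : ℝ) < criticalProbI d := by rw [hqcoe]; show pc - sn < pc; linarith
    have hpq : (criticalProbI d : ℝ) - q = sn := by rw [hqcoe]; show pc - (pc - sn) = sn; ring
    have hent := oneArm_criticalProb_le_entropic_chi hd n q hq0 hqc
    rw [hpq] at hent
    -- the three inputs at `q`
    have harm := hArm' q (by rw [hqcoe]; linarith) (by rw [hqcoe]; linarith) n hnn
    rw [show pc - (q : ℝ) = sn by rw [hqcoe]; ring, hsnν] at harm
    have hexp : Real.exp (-(x * n) / A') = (n : ℝ) ^ (-L) := by
      have : -(x * n) / A' = -(L * Real.log n) := by rw [hx]; field_simp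
      rw [this, Real.rpow_def_of_pos hn0]
      ring_nf
    rw [hexp] at harm
    have hπq : oneArmProb d q n ≤ A' * (n : ℝ) ^ (-a) := by
      calc oneArmProb d q n ≤ A' * (n : ℝ) ^ ((d : ℝ) - 1) * (n : ℝ) ^ (-L) := harm
        _ = A' * (n : ℝ) ^ (-a) := by
            rw [mul_assoc, ← Real.rpow_add hn0, hL]; ring_nf
    have hχq : chi d q ≤ M * sn ^ (-g) := by
      have h := hχ q (by rw [hqcoe]; linarith) hqc
      rwa [hpq] at h
    have hcoef : 8 * d / ((q : ℝ) * (1 - criticalProbI d) ^ 2) ≤ K := by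
      rw [hK, ← hpcdef]
      have h1pc : 0 < (1 - pc) ^ 2 := pow_pos (by linarith) 2
      have hqge : pc / 2 ≤ (q : ℝ) := by rw [hqcoe]; linarith
      have hden : pc / 2 * (1 - pc) ^ 2 ≤ (q : ℝ) * (1 - pc) ^ 2 := mul_le_mul_of_nonneg_right hqge h1pc.le
      calc 8 * (d : ℝ) / ((q : ℝ) * (1 - pc) ^ 2) ≤ 8 * d / (pc / 2 * (1 - pc) ^ 2) :=
            div_le_div_of_nonneg_left (by positivity) (mul_pos (by linarith) h1pc) hden
        _ = 16 * d / (pc * (1 - pc) ^ 2) := by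
            field_simp
            ring
    -- `s² · s^{-g} = (A'L)^a (log n)^a n^{-a}`
    have hss : sn ^ 2 * sn ^ (-g) = (A' * L) ^ a * Real.log n ^ a * (n : ℝ) ^ (-a) := by
      have h1 : sn ^ 2 * sn ^ (-g) = sn ^ (2 - g) := by
        rw [← Real.rpow_natCast sn 2, ← Real.rpow_add hsn0]; norm_num; ring_nf
      have h2 : sn ^ (2 - g) = x ^ a := by
        rw [hsn, ← Real.rpow_mul hx0.le, ha]; congr 1; field_simp
      have h3 : x ^ a = (A' * L) ^ a * Real.log n ^ a * (n : ℝ) ^ (-a) := by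
        rw [hx, Real.div_rpow (by positivity) hn0.le, Real.mul_rpow (by positivity) hlog0.le,
          Real.rpow_neg hn0.le, div_eq_mul_inv]
      rw [h1, h2, h3]
    -- the logarithm absorbed: `(log n)^a n^{-a} ≤ ε^{-a} n^{-c}`
    have hlogabs : Real.log n ^ a * (n : ℝ) ^ (-a) ≤ ε⁻¹ ^ a * (n : ℝ) ^ (-c) := by
      have h1 := log_rpow_le a ε ha0.le hε0 hn1
      rw [haε] at h1
      calc Real.log n ^ a * (n : ℝ) ^ (-a) ≤ ε⁻¹ ^ a * (n : ℝ) ^ (a - c) * (n : ℝ) ^ (-a) :=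
            mul_le_mul_of_nonneg_right h1 (Real.rpow_nonneg hn0.le _)
        _ = ε⁻¹ ^ a * (n : ℝ) ^ (-c) := by
            rw [mul_assoc, ← Real.rpow_add hn0]; ring_nf
    have hac : (n : ℝ) ^ (-a) ≤ (n : ℝ) ^ (-c) :=
      Real.rpow_le_rpow_of_exponent_le hn1 (by linarith)
    -- assemble
    have hchi0 : 0 ≤ chi d q := le_trans zero_le_one (one_le_chi hd q (by rw [← coe_criticalProbI]; exact hqc))
    have hcoef0 : 0 ≤ 8 * d / ((q : ℝ) * (1 - criticalProbI d) ^ 2) := by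
      have : 0 < 1 - (criticalProbI d : ℝ) := by rw [← hpcdef]; linarith
      positivity
    rw [show (bondPercolation (zdGraph d) q).real (siteToBoundary d n) = oneArmProb d q n from rfl] at hent
    calc (bondPercolation (zdGraph d) (criticalProbI d)).real (siteToBoundary d n)
        ≤ 2 * oneArmProb d q n + 8 * d / ((q : ℝ) * (1 - criticalProbI d) ^ 2) * sn ^ 2 * chi d q := hent
      _ ≤ 2 * (A' * (n : ℝ) ^ (-a)) + K * sn ^ 2 * (M * sn ^ (-g)) := by
          gcongr
      _ = 2 * A' * (n : ℝ) ^ (-a) + K * M * (sn ^ 2 * sn ^ (-g)) := by ring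
      _ = 2 * A' * (n : ℝ) ^ (-a) + K * M * (A' * L) ^ a * (Real.log n ^ a * (n : ℝ) ^ (-a)) := by
          rw [hss]; ring
      _ ≤ 2 * A' * (n : ℝ) ^ (-c) + K * M * (A' * L) ^ a * (ε⁻¹ ^ a * (n : ℝ) ^ (-c)) := by
          gcongr
      _ = C₁ * (n : ℝ) ^ (-c) := by rw [hC₁]; ring
  -- small `n`: `π ≤ 1 ≤ n₁^c n^{-c}`
  refine ⟨C₁ + (n₁ : ℝ) ^ c, fun n hn => ?_⟩
  have hn0 : (0 : ℝ) < n := by exact_mod_cast hn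
  have hnc0 : 0 ≤ (n : ℝ) ^ (-c) := Real.rpow_nonneg hn0.le _
  have hn₁c : 0 ≤ (n₁ : ℝ) ^ c := Real.rpow_nonneg (Nat.cast_nonneg _) _
  by_cases hle : n₁ ≤ n
  · calc (bondPercolation (zdGraph d) (criticalProbI d)).real (siteToBoundary d n)
        ≤ C₁ * (n : ℝ) ^ (-c) := hmain n hle
      _ ≤ (C₁ + (n₁ : ℝ) ^ c) * (n : ℝ) ^ (-c) := mul_le_mul_of_nonneg_right (by linarith) hnc0
  · push Not at hle
    have hle' : (n : ℝ) ≤ n₁ := by exact_mod_cast hle.le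
    have h1 : 1 ≤ (n₁ : ℝ) ^ c * (n : ℝ) ^ (-c) := by
      rw [Real.rpow_neg hn0.le, ← div_eq_mul_inv, le_div_iff₀ (Real.rpow_pos_of_pos hn0 _), one_mul]
      exact Real.rpow_le_rpow hn0.le hle' hc0.le
    calc (bondPercolation (zdGraph d) (criticalProbI d)).real (siteToBoundary d n)
        ≤ 1 := measureReal_le_one
      _ ≤ (n₁ : ℝ) ^ c * (n : ℝ) ^ (-c) := h1
      _ ≤ (C₁ + (n₁ : ℝ) ^ c) * (n : ℝ) ^ (-c) := mul_le_mul_of_nonneg_right (by linarith) hnc0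

/-- Existential form of route C2: the two typed inputs with `g < 2`, `ν > 0` give `OneArmPolyDecay d`.  CONDITIONAL.
[cite: DewanMuirhead2022, Thm. 1.10] -/
theorem oneArmPolyDecay_of_subcriticalArmDecay (hd : 2 ≤ d) {A ν δ₁ M g δ₀ : ℝ} (hν : 0 < ν)
    (hg : g < 2) (hδ₁ : 0 < δ₁) (hδ₀ : 0 < δ₀)
    (hArm : ∀ q : unitInterval, (criticalProbI d : ℝ) - δ₁ < q → (q : ℝ) < criticalProbI d → ∀ n : ℕ, 1 ≤ n →
      oneArmProb d q n ≤ A * (n : ℝ) ^ ((d : ℝ) - 1) * Real.exp (-(((criticalProbI d : ℝ) - q) ^ ν * n) / A))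
    (hχ : ∀ q : unitInterval, (criticalProbI d : ℝ) - δ₀ < q → (q : ℝ) < criticalProbI d →
      chi d q ≤ M * ((criticalProbI d : ℝ) - q) ^ (-g)) :
    OneArmPolyDecay d := by
  have ha0 : 0 < (2 - g) / ν := div_pos (by linarith) hν
  obtain ⟨C, hC⟩ := oneArmPolyDecayAtCritical_of_subcriticalArmDecay hd hν hg hδ₁ hδ₀ hArm hχ
    (half_pos ha0) (half_lt_self ha0)
  exact ⟨(2 - g) / ν / 2, half_pos ha0, C, hC⟩

end RouteC2

end Summit.CriticalPhenomena.PercolationContinuityZ3.Theorems.Quant
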